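import Summits.ResolutionOfSingularities.ResolutionOfSingularities.Theorems.PurelyInseparableDim4FrameTraps
import HarnessLib
import HarnessLib.Audit.Tags

/-!
# Purely inseparable fourfolds — under F4-I every trap contains a NON-ISOLATED state
# [OURS · counted 0 · a statement about OUR frame (`PurelyInseparableDim4Scope`/`Rules`), not about resolution]

Census cell «res-dim4-pi» (D-0157 DOOR 2), width seat `res-dim4-p-14`, brick PR-12n.  The census reads
every trap state found so far as BLIND-REGULAR (EN-9), in particular non-isolated, and F4-I
`NoIsolatedTrap p q` is being bridged to a tree theorem at `(p,q) = (2,2)` (WORD #30 (b)).  This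
DEF-FREE file records the consequence of F4-I for the trap census, for any `p, q`:

* **`exists_not_isIsolated_of_isTrap`**: `NoIsolatedTrap p q →` every nonempty `IsTrap q T` over a
  field of characteristic `p` contains a state whose `q`-fold origin is NOT isolated (player B, answering
  the point centre inside `T`, would otherwise run an infinite isolated `Step0` chain);
* `exists_not_isIsolated_reachable_of_isTrap` — indeed from EVERY state of the trap a non-isolated
  state of the trap is reached along point-blow-up edges inside `T`;
* `noIsolatedTrap_iff_forall_isolatedSet` — restatement: F4-I ⟺ no nonempty set of isolated `q`-fold
  states is closed under «some point-blow-up edge stays inside» (PR-12d's kill shape, recalled).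

Nothing here proves `NoIsolatedTrap` or resolution of singularities in dimension ≥ 4 / characteristic
`p`; counted 0; AI work, weaker than expert review.
bears_on: LADDER-RESOLUTION:D157-DOOR2 (res-dim4-pi · PR-12n). Supports stmt-ResolutionOfSingularities-16155
(helper).
-/

set_option linter.dupNamespace false

noncomputable section

namespace Summit.ResolutionOfSingularities.ResolutionOfSingularities.Theorems.PIDim4

namespace TrapsMeetNonIsolated

open Literature.AlgebraicGeometry.Resolution

variable {p q : ℕ} {K : Type} [Field K] [CharP K p] [DecidableEq K]

/-- Inside a trap, the point centre is always answered: from every state of `T` there is a `Step0`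
edge into `T`. [folklore] -/
theorem exists_step0_mem_of_isTrap {T : Set (State K)} (hT : IsTrap q T) {s : State K} (hs : s ∈ T) :
    ∃ s' ∈ T, Step0 q s s' := by
  obtain ⟨hord, hall⟩ := hT s hs
  obtain ⟨s', hs', hedge⟩ := hall Finset.univ ⟨Finset.univ_nonempty, hord⟩
  exact ⟨s', hs', hord, hedge⟩

omit [CharP K p] in
/-- A set of isolated states closed under «some `Step0` edge stays inside» carries an infinite isolated
`Step0` chain from each of its states. [folklore] -/
theorem exists_chain_of_isolatedSet {T : Set (State K)}
    (hT : ∀ s ∈ T, IsIsolated q s.F ∧ ∃ s' ∈ T, Step0 q s s') {s₀ : State K} (hs₀ : s₀ ∈ T) :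
    ∃ c : ℕ → State K, c 0 = s₀ ∧ ∀ k, IsIsolated q (c k).F ∧ Step0 q (c k) (c (k + 1)) := by
  have key : ∀ s : T, ∃ s' : T, IsIsolated q s.1.F ∧ Step0 q s.1 s'.1 := by
    rintro ⟨s, hs⟩
    obtain ⟨hiso, s', hs', hstep⟩ := hT s hs
    exact ⟨⟨s', hs'⟩, hiso, hstep⟩
  choose f hf using key
  refine ⟨fun k => (f^[k] ⟨s₀, hs₀⟩).1, rfl, fun k => ?_⟩
  show IsIsolated q (f^[k] ⟨s₀, hs₀⟩).1.F ∧ Step0 q (f^[k] ⟨s₀, hs₀⟩).1 (f^[k + 1] ⟨s₀, hs₀⟩).1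
  rw [Function.iterate_succ_apply']
  exact hf _

/-- **Under F4-I every nonempty trap contains a NON-ISOLATED state.** [folklore] -/
theorem exists_not_isIsolated_of_isTrap (h : NoIsolatedTrap p q) {T : Set (State K)} (hT : IsTrap q T)
    (hne : T.Nonempty) : ∃ s ∈ T, ¬ IsIsolated q s.F := by
  by_contra hall
  push Not at hall
  obtain ⟨s₀, hs₀⟩ := hne
  obtain ⟨c, -, hc⟩ := exists_chain_of_isolatedSet (q := q)
    (fun s hs => ⟨hall s hs, exists_step0_mem_of_isTrap hT hs⟩) hs₀
  exact h K ⟨c, hc⟩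

/-- **… indeed from EVERY state of the trap a non-isolated state of the trap is reachable along
`Step0` edges inside the trap** (else the isolated part of `T` reachable from `s` would be a
self-sustaining isolated set). [folklore] -/
theorem exists_not_isIsolated_reachable_of_isTrap (h : NoIsolatedTrap p q) {T : Set (State K)}
    (hT : IsTrap q T) {s : State K} (hs : s ∈ T) :
    ∃ s' ∈ T, ¬ IsIsolated q s'.F ∧ Relation.ReflTransGen (fun a b => b ∈ T ∧ Step0 q a b) s s' := by
  by_contra hnone
  push Not at hnone
  -- the part of `T` reachable from `s` consists of isolated states and is `Step0`-closed inside `T`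
  let R : Set (State K) := {t | t ∈ T ∧ Relation.ReflTransGen (fun a b => b ∈ T ∧ Step0 q a b) s t}
  have hR : ∀ t ∈ R, IsIsolated q t.F ∧ ∃ t' ∈ R, Step0 q t t' := by
    rintro t ⟨htT, hreach⟩
    refine ⟨by_contra fun hni => hnone t htT hni hreach, ?_⟩
    obtain ⟨t', ht'T, hstep⟩ := exists_step0_mem_of_isTrap hT htT
    exact ⟨t', ⟨ht'T, hreach.tail ⟨ht'T, hstep⟩⟩, hstep⟩
  obtain ⟨c, -, hc⟩ := exists_chain_of_isolatedSet (q := q) hR (s₀ := s) ⟨hs, Relation.ReflTransGen.refl⟩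
  exact h K ⟨c, hc⟩

omit [CharP K p] [DecidableEq K] in
/-- Restatement of PR-12d's kill shape, one field: no infinite isolated `Step0` chain over `K` iff no
nonempty `Step0`-closed set of isolated states over `K`. [folklore] -/
theorem not_exists_chain_iff_not_exists_isolatedSet [DecidableEq K] :
    (¬ ∃ c : ℕ → State K, ∀ k, IsIsolated q (c k).F ∧ Step0 q (c k) (c (k + 1))) ↔
      ¬ ∃ T : Set (State K), T.Nonempty ∧ ∀ s ∈ T, IsIsolated q s.F ∧ ∃ s' ∈ T, Step0 q s s' := by
  constructor
  · rintro h ⟨T, ⟨s₀, hs₀⟩, hT⟩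
    obtain ⟨c, -, hc⟩ := exists_chain_of_isolatedSet hT hs₀
    exact h ⟨c, hc⟩
  · rintro h ⟨c, hc⟩
    exact h ⟨Set.range c, ⟨c 0, 0, rfl⟩, by
      rintro _ ⟨k, rfl⟩
      exact ⟨(hc k).1, c (k + 1), ⟨k + 1, rfl⟩, (hc k).2⟩⟩

end TrapsMeetNonIsolated

end Summit.ResolutionOfSingularities.ResolutionOfSingularities.Theorems.PIDim4

end
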